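import Literature.NumberTheory.Sieve.PrimeThreeTermProgressions
import Mathlib.Analysis.SpecialFunctions.Integrals.Basic
import HarnessLib

/-!
# Green–Tao 2010, Example 8 at `k = 3` — II: van der Corput's theorem with the Hardy–Littlewood constant — PROVED

Topic `Literature/NumberTheory/Sieve`. Source: B. Green, T. Tao, *Linear equations in primes*,
Ann. of Math. 171 (2010), §1 Example 8 (arXiv:math/0606088 p. 7), case `k = 3` ("the `k = 3`
case is due to van der Corput"): the number of triples of primes `p₁ < p₂ < p₃ ≤ N` in
arithmetic progression is
`(¼ ∏_p β_p + o(1)) N² / log³ N`, `β₂ = 2`, `β_p = (1 − 2/p)(p/(p−1))²` (`p ≥ 3`).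

This file finishes the instance begun in `PrimeThreeTermProgressions`:

* `archFactor_threeAPSystem`: `β_∞ = vol{1 ≤ x, 1 ≤ y, x + 2y ≤ N} = (N − 3)²/4` (`N ≥ 3`);
* `GreenTao2010_example8_three`: the asymptotic, UNCONDITIONALLY, from the tree's proof of the
  counting form (1.8) at complexity `1` (`GreenTao2010_primePointCountAtComplexity_one`, with
  `d = 2`, `t = 3`, `‖Ψ‖_N = 6`), the `o(N²/log³N)` absorbing `β_∞ − N²/4 = O(N)`.

The Euler factors of `∏_p β_p` are the explicit `threeAPLocalFactor`
(`singularProductPartial_threeAPSystem`), and `∏_p β_p > 0` (`singularProduct_threeAPSystem_pos`).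

## References

* [GreenTao2010] B. Green, T. Tao, *Linear equations in primes*, Ann. of Math. (2) 171 (2010),
  §1 Example 8, (1.4), (1.8).
* [vanderCorput1939] J. G. van der Corput, *Über Summen von Primzahlen und Primzahlquadraten*,
  Math. Ann. 116 (1939), 1–50.
-/

noncomputable section

open MeasureTheory Set

namespace Literature.NumberTheory.Sieve

/-! ### The archimedean factor: the area of the triangle -/

/-- [folklore] -/
private theorem hasDerivAt_threeAP_prim (c x : ℝ) :
    HasDerivAt (fun x : ℝ => (c / 2 - 1) * x - x ^ 2 / 4) ((c - x) / 2 - 1) x := by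
  have h1 : HasDerivAt (fun x : ℝ => (c / 2 - 1) * x) (c / 2 - 1) x := by
    simpa using (hasDerivAt_id x).const_mul (c / 2 - 1)
  have h2 : HasDerivAt (fun x : ℝ => x ^ 2 / 4) (2 * x / 4) x := by
    simpa using (hasDerivAt_pow 2 x).div_const 4
  have h := h1.sub h2
  have e : c / 2 - 1 - 2 * x / 4 = (c - x) / 2 - 1 := by ring
  rw [e] at h
  exact h

/-- [folklore] -/
private theorem integral_threeAP_height (c : ℝ) :
    ∫ x in (1 : ℝ)..(c - 2), ((c - x) / 2 - 1) = (c - 3) ^ 2 / 4 := by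
  rw [intervalIntegral.integral_eq_sub_of_hasDerivAt (fun x _ => hasDerivAt_threeAP_prim c x)
    ((by fun_prop : Continuous fun x : ℝ => (c - x) / 2 - 1).intervalIntegrable _ _)]
  ring

/-- **`β_∞` for three-term progressions**: the positive part of the triangle
`{1 ≤ x, 1 ≤ y, x + 2y ≤ N}` is the triangle itself, of area `(N − 3)²/4` (`N ≥ 3`).
[cite: GreenTao2010, (1.4), §1 Example 8] -/
theorem archFactor_threeAPSystem (N : ℕ) (hN : 3 ≤ N) :
    archFactor threeAPSystem (threeAPRegion N) = ((N : ℝ) - 3) ^ 2 / 4 := by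
  unfold archFactor
  have hN' : (3 : ℝ) ≤ N := by exact_mod_cast hN
  set E : Set (ℝ × ℝ) := {p | 1 ≤ p.1 ∧ 1 ≤ p.2 ∧ p.1 + 2 * p.2 ≤ N} with hE
  have hEm : MeasurableSet E := by
    have : E = {p : ℝ × ℝ | 1 ≤ p.1} ∩ ({p : ℝ × ℝ | 1 ≤ p.2} ∩ {p : ℝ × ℝ | p.1 + 2 * p.2 ≤ N}) := by
      ext p; simp [hE]
    rw [this]
    exact (isClosed_le continuous_const continuous_fst).measurableSet.inter
      ((isClosed_le continuous_const continuous_snd).measurableSet.inter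
        (isClosed_le (by fun_prop) continuous_const).measurableSet)
  have hset : threeAPRegion N ∩ {x | ∀ i, 0 < (threeAPSystem i).realEval x} =
      MeasurableEquiv.finTwoArrow ⁻¹' E := by
    ext x
    constructor
    · rintro ⟨hx, -⟩
      simpa [hE, threeAPRegion, MeasurableEquiv.finTwoArrow_apply] using hx
    · intro hx
      have hx' : x ∈ threeAPRegion N := by
        simpa [hE, threeAPRegion, MeasurableEquiv.finTwoArrow_apply] using hx
      exact ⟨hx', fun i => realEval_threeAPSystem_pos hx' i⟩
  rw [hset, (volume_preserving_finTwoArrow ℝ).measure_preimage hEm.nullMeasurableSet,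
    show (volume : Measure (ℝ × ℝ)) = volume.prod volume from rfl, Measure.prod_apply hEm]
  -- the sections of the triangle
  have hsec : ∀ x : ℝ, volume (Prod.mk x ⁻¹' E) =
      (Ici (1 : ℝ)).indicator (fun x => ENNReal.ofReal (((N : ℝ) - x) / 2 - 1)) x := by
    intro x
    by_cases hx : 1 ≤ x
    · rw [indicator_of_mem (mem_Ici.mpr hx)]
      have : Prod.mk x ⁻¹' E = Icc 1 (((N : ℝ) - x) / 2) := by
        ext y
        simp only [mem_preimage, hE, mem_setOf_eq, mem_Icc]
        constructor
        · rintro ⟨-, h1, h2⟩; exact ⟨h1, by linarith⟩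
        · rintro ⟨h1, h2⟩; exact ⟨hx, h1, by linarith⟩
      rw [this, Real.volume_Icc]
    · rw [indicator_of_notMem (by simpa using hx)]
      have : Prod.mk x ⁻¹' E = ∅ := by
        ext y
        simp only [mem_preimage, hE, mem_setOf_eq, mem_empty_iff_false, iff_false]
        exact fun h => hx h.1
      rw [this, measure_empty]
  rw [lintegral_congr hsec, lintegral_indicator measurableSet_Ici,
    ← Icc_union_Ioi_eq_Ici (show (1 : ℝ) ≤ (N : ℝ) - 2 by linarith),
    lintegral_union measurableSet_Ioi
      (disjoint_left.mpr fun y hy hy' => not_lt.mpr (mem_Icc.mp hy).2 (mem_Ioi.mp hy'))]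
  have hzero : ∫⁻ x in Ioi ((N : ℝ) - 2), ENNReal.ofReal (((N : ℝ) - x) / 2 - 1) = 0 :=
    setLIntegral_eq_zero measurableSet_Ioi fun x hx => by
      simp only [mem_Ioi] at hx
      simp only [Pi.zero_apply]
      exact ENNReal.ofReal_of_nonpos (by linarith)
  rw [hzero, add_zero]
  have hint : IntegrableOn (fun x : ℝ => ((N : ℝ) - x) / 2 - 1) (Icc 1 ((N : ℝ) - 2)) volume :=
    (by fun_prop : Continuous fun x : ℝ => ((N : ℝ) - x) / 2 - 1).integrableOn_Icc
  have hnn : 0 ≤ᵐ[volume.restrict (Icc 1 ((N : ℝ) - 2))] fun x : ℝ => ((N : ℝ) - x) / 2 - 1 :=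
    ae_restrict_of_forall_mem measurableSet_Icc fun x hx => by
      simp only [mem_Icc] at hx
      simp only [Pi.zero_apply]
      linarith
  rw [← ofReal_integral_eq_lintegral_ofReal hint hnn, integral_Icc_eq_integral_Ioc,
    ← intervalIntegral.integral_of_le (by linarith), integral_threeAP_height (N : ℝ),
    ENNReal.toReal_ofReal (by positivity)]

/-! ### van der Corput's theorem with the Hardy–Littlewood constant -/

/-- **Green–Tao 2010, Example 8 at `k = 3` (van der Corput 1939, with the Hardy–Littlewood
constant) — PROVED.** The number of triples of primes `p₁ < p₂ < p₃ ≤ N` in arithmetic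
progression is `(¼ ∏_p β_p + o(1)) N²/log³ N`, with `β₂ = 2`, `β_p = (1 − 2/p)(p/(p−1))²`
(`p ≥ 3`; `localFactor_threeAPSystem`): for every `ε > 0` and `N ≥ N₀(ε)`,
`|#{p₁ < p₂ < p₃ ≤ N in AP} − ¼ ∏_p β_p · N²/log³N| ≤ ε N²/log³N`. Unconditional: `GI(1)` and
`MN(1)` are classical and the tree proves the `s = 1` case of the Main Theorem.
[cite: GreenTao2010, §1 Example 8 (k = 3)] -/
theorem GreenTao2010_example8_three : ∀ ε : ℝ, 0 < ε → ∃ N₀ : ℕ, ∀ N : ℕ, N₀ ≤ N →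
    |(primeThreeAPCount N : ℝ) -
        (1 / 4 : ℝ) * singularProduct threeAPSystem * (N : ℝ) ^ 2 / Real.log N ^ 3| ≤
      ε * (N : ℝ) ^ 2 / Real.log N ^ 3 := by
  intro ε hε
  have hS0 : 0 < singularProduct threeAPSystem := singularProduct_threeAPSystem_pos
  set S : ℝ := singularProduct threeAPSystem with hS
  set ε' : ℝ := ε / (2 * (S / 4 + 1)) with hε'
  have hε'0 : 0 < ε' := by positivity
  obtain ⟨N₁, hN₁⟩ :=
    GreenTao2010_primePointCountAtComplexity_one 2 3 6 (by norm_num) (by norm_num) ε' hε'0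
  refine ⟨max (max N₁ 3) ⌈3 * S / ε⌉₊, fun N hN => ?_⟩
  have hN1 : N₁ ≤ N := le_trans (le_trans (le_max_left _ _) (le_max_left _ _)) hN
  have hN3 : 3 ≤ N := le_trans (le_trans (le_max_right _ _) (le_max_left _ _)) hN
  have hNc : ⌈3 * S / ε⌉₊ ≤ N := le_trans (le_max_right _ _) hN
  have hNε : 3 * S ≤ ε * N := by
    have h := le_trans (Nat.le_ceil (3 * S / ε)) (show (⌈3 * S / ε⌉₊ : ℝ) ≤ N by exact_mod_cast hNc)
    rw [div_le_iff₀ hε] at h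
    linarith
  have hNr : (3 : ℝ) ≤ N := by exact_mod_cast hN3
  have hL : 0 < Real.log N ^ 3 := pow_pos (Real.log_pos (by linarith)) 3
  have key := hN₁ N hN1 threeAPSystem isNondegenerateSystem_threeAPSystem
    complexity_threeAPSystem.le (affLinSize_threeAPSystem N).le (threeAPRegion N)
    (convex_threeAPRegion N) (threeAPRegion_subset_realBox N)
  rw [← primeThreeAPCount_eq, archFactor_threeAPSystem N hN3] at key
  set P : ℝ := (primeThreeAPCount N : ℝ)
  set Lg : ℝ := Real.log N ^ 3
  -- the main term moves by `O(N · 𝔖 / log³ N)`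
  have hdiff : |((N : ℝ) - 3) ^ 2 / 4 * S / Lg - 1 / 4 * S * (N : ℝ) ^ 2 / Lg| ≤
      3 / 2 * S * N / Lg := by
    rw [← sub_div, abs_div, abs_of_pos hL]
    refine div_le_div_of_nonneg_right ?_ hL.le
    rw [show ((N : ℝ) - 3) ^ 2 / 4 * S - 1 / 4 * S * (N : ℝ) ^ 2 = -(S * (6 * N - 9) / 4) by ring,
      abs_neg, abs_of_nonneg (by nlinarith)]
    nlinarith
  have hmain : ε' * (((N : ℝ) - 3) ^ 2 / 4 * S + (N : ℝ) ^ 2) ≤ ε / 2 * (N : ℝ) ^ 2 := by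
    have h1 : ((N : ℝ) - 3) ^ 2 / 4 * S ≤ (N : ℝ) ^ 2 / 4 * S := by
      refine mul_le_mul_of_nonneg_right (div_le_div_of_nonneg_right ?_ (by norm_num)) hS0.le
      nlinarith
    calc ε' * (((N : ℝ) - 3) ^ 2 / 4 * S + (N : ℝ) ^ 2)
        ≤ ε' * ((N : ℝ) ^ 2 / 4 * S + (N : ℝ) ^ 2) := by gcongr
      _ = ε / 2 * (N : ℝ) ^ 2 := by rw [hε']; field_simp
  have hsec : 3 / 2 * S * N ≤ ε / 2 * (N : ℝ) ^ 2 := by nlinarith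
  calc |P - 1 / 4 * S * (N : ℝ) ^ 2 / Lg|
      ≤ |P - ((N : ℝ) - 3) ^ 2 / 4 * S / Lg| +
          |((N : ℝ) - 3) ^ 2 / 4 * S / Lg - 1 / 4 * S * (N : ℝ) ^ 2 / Lg| := abs_sub_le _ _ _
    _ ≤ ε' * (((N : ℝ) - 3) ^ 2 / 4 * S + (N : ℝ) ^ 2) / Lg + 3 / 2 * S * N / Lg :=
        add_le_add key hdiff
    _ ≤ ε / 2 * (N : ℝ) ^ 2 / Lg + ε / 2 * (N : ℝ) ^ 2 / Lg :=
        add_le_add (div_le_div_of_nonneg_right hmain hL.le) (div_le_div_of_nonneg_right hsec hL.le)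
    _ = ε * (N : ℝ) ^ 2 / Lg := by ring

/-- The same with the Euler factors spelled out: the constant is `¼ ∏_p β_p` where the partial
products `∏_{p ≤ x} β_p` are `∏_{p ≤ x} threeAPLocalFactor p` (`β₂ = 2`,
`β_p = p(p−2)/(p−1)²`) and `∏_p β_p` is their limit, which is positive.
[cite: GreenTao2010, §1 Example 8 (k = 3)] -/
theorem GreenTao2010_example8_three_eulerFactors :
    (∀ x : ℕ, singularProductPartial threeAPSystem x = ∏ p ∈ Nat.primesLE x, threeAPLocalFactor p) ∧
    Filter.Tendsto (singularProductPartial threeAPSystem) Filter.atTop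
      (nhds (singularProduct threeAPSystem)) ∧
    0 < singularProduct threeAPSystem :=
  ⟨singularProductPartial_threeAPSystem,
    tendsto_singularProductPartial_holds 2 3 threeAPSystem isNondegenerateSystem_threeAPSystem,
    singularProduct_threeAPSystem_pos⟩

end Literature.NumberTheory.Sieve

end
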